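import Summits.Ventures.PercRepro.Night2ParallelGeneralCore

/-!
# PercRepro — `ShadowC025` reduces to simple matroids (night-2, gen 11)

With the parallel reduction at every `(p, q)` (`Night2ParallelGeneralCore.lean`, `shadow_card_of_parallel_gen`):

* **`shadowHall_of_eRank_of_simple`**: if the shadow form at every `(p, q)` holds on the SIMPLE matroids of rank
  `p` (no loops, any two distinct elements of rank `2`), it holds on every matroid of rank `p` (strong induction
  on `|E|`: delete a loop (`shadowHall_of_delete_loop`), or one element of a parallel pair — the contraction
  side is the pair `(p − 1, q − 1)` with `phiK (p − 1) (q − 1) ≥ phiK p q`, p3's `phiK_succ_succ_le`; at `q = 0`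
  the contraction side is void);
* **`shadowC025_of_simple`**: `ShadowC025` (the lane's statement of record) follows from its restriction to
  simple matroids of rank `p` (rank `< p` has no bottom set, rank `≥ p` truncates to rank `p`).
-/

open scoped Matroid

namespace PercRepro.Shadow

open Finset PerFlat ThmH

variable {α : Type} [DecidableEq α]

section Reduction

/-- **The shadow form at every `(p, q)` reduces to simple matroids of rank `p`.**  If, for every `q + 2 ≤ p`,
`ShadowHall N p q (phiK p q)` holds on every matroid `N` of rank `p` without loops and parallel pairs, then it
holds on every matroid of rank `p`.  Strong induction on `|E|`, simultaneously in `(p, q)`: a loop is deleted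
(`shadowHall_of_delete_loop`), one element of a parallel pair is deleted (`shadow_card_of_parallel_gen`, with the
contraction side at `(p − 1, q − 1)` and `phiK p q ≤ phiK (p − 1) (q − 1)` by `phiK_succ_succ_le`). -/
theorem shadowHall_of_eRank_of_simple
    (hsimple : ∀ (N : Matroid α) [N.Finite] (p q : ℕ), q + 2 ≤ p → N.eRank = (p : ℕ∞) →
      (∀ e ∈ gr N, ∀ f ∈ gr N, e ≠ f → rkN N {e, f} = 2) → ShadowHall N p q (phiK p q))
    {p q : ℕ} (hpq : q + 2 ≤ p) (M : Matroid α) [M.Finite] (hM : M.eRank = (p : ℕ∞)) :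
    ShadowHall M p q (phiK p q) := by
  classical
  suffices h : ∀ (n : ℕ) (p q : ℕ), q + 2 ≤ p → ∀ (N : Matroid α) [N.Finite], (gr N).card ≤ n →
      N.eRank = (p : ℕ∞) → ShadowHall N p q (phiK p q) from h (gr M).card p q hpq M le_rfl hM
  intro n
  induction n using Nat.strong_induction_on with
  | _ n ihn =>
    intro p q hpq N _ hn hN
    by_cases hL : ∃ ℓ ∈ N.E, ¬ N.Indep {ℓ}
    · -- a loop: delete it
      obtain ⟨ℓ, hℓ, hl⟩ := hL
      have hℓg : ℓ ∈ gr N := by rw [← Finset.mem_coe, coe_gr]; exact hℓ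
      have hcard : (gr (N ＼ ({ℓ} : Set α))).card < n := by
        rw [gr_delete, Finset.card_erase_of_mem hℓg]
        have : 0 < (gr N).card := Finset.card_pos.2 ⟨ℓ, hℓg⟩
        omega
      have hloop : N.IsLoop ℓ := by
        by_contra h
        exact hl (Matroid.indep_singleton.2 ((Matroid.not_isLoop_iff hℓ).1 h))
      have hrk : (N ＼ ({ℓ} : Set α)).eRank = (p : ℕ∞) := by
        rw [eRank_delete_of_mem_closure (hloop.mem_closure _), hN]
      exact shadowHall_of_delete_loop hℓ hl (phiK_nonneg_gen p q)
        (ihn _ hcard p q hpq (N ＼ ({ℓ} : Set α)) le_rfl hrk)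
    · have hloopless : ∀ e ∈ gr N, N.Indep {e} := indep_singleton_of_no_loop hL
      by_cases hP : ∀ e ∈ gr N, ∀ f ∈ gr N, e ≠ f → rkN N {e, f} = 2
      · exact hsimple N p q hpq hN hP
      · -- a parallel pair `e`, `f`: delete `f`
        push Not at hP
        obtain ⟨e, he, f, hf, hef, hr⟩ := hP
        have hfE : f ∈ N.E := by rw [← coe_gr, Finset.mem_coe]; exact hf
        have heE : e ∈ N.E := by rw [← coe_gr, Finset.mem_coe]; exact he
        have hcl : f ∈ N.closure {e} := by
          by_contra h
          exact hr (rkN_pair_eq_two_of_notMem_closure (hloopless e he) hfE h)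
        have hcard : (gr (N ＼ ({f} : Set α))).card < n := by
          rw [gr_delete, Finset.card_erase_of_mem hf]
          have : 0 < (gr N).card := Finset.card_pos.2 ⟨f, hf⟩
          omega
        have hrk : (N ＼ ({f} : Set α)).eRank = (p : ℕ∞) := by
          rw [eRank_delete_of_mem_closure, hN]
          have hsub : ({e} : Set α) ⊆ N.E \ {f} :=
            Set.singleton_subset_iff.2 ⟨heE, fun h => hef (Set.mem_singleton_iff.1 h)⟩
          exact N.closure_subset_closure hsub hcl
        intro 𝒜 h𝒜
        by_cases hq : 1 ≤ q
        · -- contraction side at `(p − 1, q − 1)`, constant `phiK (p − 1) (q − 1) ≥ phiK p q` (Lemma E)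
          have hcard' : (gr (N ／ ({f} : Set α))).card < n := by
            rw [gr_contract, Finset.card_erase_of_mem hf]
            have : 0 < (gr N).card := Finset.card_pos.2 ⟨f, hf⟩
            omega
          have hrk' : (N ／ ({f} : Set α)).eRank = ((p - 1 : ℕ) : ℕ∞) :=
            eRank_contract_singleton (hloopless f hf) hN
          have hphi : phiK p q ≤ phiK (p - 1) (q - 1) := by
            have := phiK_succ_succ_le (p - 1) (q - 1)
            rwa [show p - 1 + 1 = p by omega, show q - 1 + 1 = q by omega] at this
          exact shadow_card_of_parallel_gen (hloopless f hf) heE hcl hef hN (phiK_nonneg_gen p q) hphi h𝒜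
            (fun _ => ihn _ hcard' (p - 1) (q - 1) (by omega) (N ／ ({f} : Set α)) le_rfl hrk')
            (ihn _ hcard p q hpq (N ＼ ({f} : Set α)) le_rfl hrk)
        · -- `q = 0`: the contraction side is void (`one_le_of_mem_clF`); any `c' ≥ c` will do
          exact shadow_card_of_parallel_gen (hloopless f hf) heE hcl hef hN (phiK_nonneg_gen p q) le_rfl h𝒜
            (fun hq' => absurd hq' hq)
            (ihn _ hcard p q hpq (N ＼ ({f} : Set α)) le_rfl hrk)

/-- **`ShadowC025` reduces to simple matroids**: if, for every `q + 2 ≤ p`, the shadow form holds on every finite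
matroid of rank `p` without loops and parallel pairs (any two distinct elements of rank `2`), then it holds on
every finite matroid at every `(p, q)` — the lane's statement of record, modulo its simple case. -/
theorem shadowC025_of_simple
    (hsimple : ∀ {α : Type} [DecidableEq α] (N : Matroid α) [N.Finite] (p q : ℕ), q + 2 ≤ p →
      N.eRank = (p : ℕ∞) → (∀ e ∈ gr N, ∀ f ∈ gr N, e ≠ f → rkN N {e, f} = 2) →
      ShadowHall N p q (phiK p q)) : ShadowC025 := by
  intro α _ M _ p q hpq
  by_cases hlt : M.eRank < (p : ℕ∞)
  · exact shadowHall_of_Uq_empty (Uq_eq_empty_of_eRank_lt hlt)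
  · have hge : (p : ℕ∞) ≤ M.eRank := not_lt.1 hlt
    apply shadowHall_of_truncate M (by omega : q < p)
    apply shadowHall_of_eRank_of_simple (fun N _ p q hpq hN hs => hsimple N p q hpq hN hs) hpq
    rw [Matroid.eRank_def, PercRepro.Matroid.truncate_ground, PercRepro.Matroid.truncate_eRk_eq_of_ge]
    rw [Matroid.eRk_ground]
    exact hge

end Reduction

end PercRepro.Shadow
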